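import Literature.Probability.Percolation.LongRangeBridgeBound
import Mathlib.NumberTheory.Harmonic.Bounds
import HarnessLib

/-!
# Long-range bond percolation on `ℤ`: usable windows have probability `≥ c(β') C^{-s}`

Topic `Literature/Probability/Percolation`; companion of `LongRangeModel.lean` (Duminil-Copin–
Garban–Tassion, AIHP 60 (2024), §2.4, proof of Lemma 3: "`P[B^i_K unbridged] ≥
∏ P[{x,y} not a bridge] ≥ ½ C^{-βθ²}`, where the first inequality is due to the FKG inequality,
and the second to a sum-integral comparison").

## Contents (all proved)

* `jumpIdx`, `jumpBridged_eq_biUnion`, `measurableSet_jumpBridged`, `isUpperSet_jumpBridged`,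
  `usable K L R c = (touched K L R c)ᶜ ∩ (jumpBridged K L R c)ᶜ`, `measurableSet_usable`;
* `sum_Ioc_inv_le_one_add_log` (`∑_{K<d≤CK} 1/d ≤ 1 + log C`, harmonic numbers),
  `exp_neg_mul_le_one_sub` (`e^{-(1+δ)u} ≤ 1 - u` for small `u`);
* `bridgeTheta β' θ₁ K R = θ₁² + (2R+1)² β'/K²` and the bound `exp_le_real_usable`:
  `P(usable) ≥ e^{-152β'} e^{-s} C^{-s}` with `s = (1+δ) β' θ₂²` (Harris' inequality for the
  decreasing events `touchedᶜ`, `bridgeᶜ`, the bridge bound, at most `d` jump pairs of length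
  `d`, `d K_d ≤ β'/d`).

## References

* H. Duminil-Copin, C. Garban, V. Tassion, *Long-range models in 1D revisited*, Ann. Inst.
  H. Poincaré Probab. Statist. 60 (2024), arXiv:2011.04642: §2.4 (Thm. 1(ii), Lemma 3).
-/

noncomputable section

namespace Literature.Probability.Percolation

open MeasureTheory SimpleGraph Literature.Probability.LatticeModels
open scoped ENNReal

/-! ### Jump pairs and the usable-window event -/

/-- The jump pairs over the extended window of the block at `c`, indexed by `(d, y)` = (length,
right endpoint): `d ∈ (8K + 2R, L]`, `y ∈ (c + 4K + R, c - 4K - R + d)`; the pair is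
`(y - d, y)`. [folklore] -/
def jumpIdx (K L R : ℕ) (c : ℤ) : Finset (Σ _ : ℕ, ℤ) :=
  (Finset.Ioc (8 * K + 2 * R) L).sigma fun d =>
    Finset.Ioc (c + (4 * K + R)) (c - (4 * K + R) + d - 1)

/-- `jumpBridged` is the finite union of the bridge events of the jump pairs. [folklore] -/
theorem jumpBridged_eq_biUnion (K L R : ℕ) (c : ℤ) :
    jumpBridged K L R c = ⋃ p ∈ jumpIdx K L R c,
      {ω | IsLongBridge L R ω (p.2 - p.1) p.2} := by
  ext ω
  simp only [jumpBridged, jumpIdx, Set.mem_setOf_eq, Set.mem_iUnion, Finset.mem_sigma,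
    Finset.mem_Ioc, exists_prop, Sigma.exists]
  constructor
  · rintro ⟨x, y, hx, hy, hL, hb⟩
    refine ⟨(y - x).toNat, y, ⟨⟨by omega, by omega⟩, by omega, by omega⟩, ?_⟩
    rwa [Int.toNat_of_nonneg (by omega), sub_sub_cancel]
  · rintro ⟨d, y, ⟨⟨hd1, hd2⟩, hy1, hy2⟩, hb⟩
    exact ⟨y - d, y, by omega, by omega, by omega, hb⟩

/-- `jumpBridged` is measurable. [folklore] -/
theorem measurableSet_jumpBridged (K L R : ℕ) (c : ℤ) : MeasurableSet (jumpBridged K L R c) := by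
  rw [jumpBridged_eq_biUnion]
  exact Finset.measurableSet_biUnion _ fun p _ => measurableSet_isLongBridge L R _ _

/-- `jumpBridged` is increasing. [folklore] -/
theorem isUpperSet_jumpBridged (K L R : ℕ) (c : ℤ) : IsUpperSet (jumpBridged K L R c) := by
  rintro ω ω' hle ⟨x, y, hx, hy, hL, hb⟩
  exact ⟨x, y, hx, hy, hL, isUpperSet_isLongBridge L R x y hle hb⟩

/-- **The usable-window event** `U(c)`: the extended window of the block at `c` is untouched by
open mid-range edges and no mid-range bridge jumps over it (our replacement for DGT's
"unbridged", see `LongRangeOneDim`).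
[cite: DuminilcopinGarbanTassion2024, §2.4 (unbridged blocks)] -/
def usable (K L R : ℕ) (c : ℤ) : Set (BondConfig ℤ) :=
  (touched K L R c)ᶜ ∩ (jumpBridged K L R c)ᶜ

/-- `usable` is measurable. [folklore] -/
theorem measurableSet_usable (K L R : ℕ) (c : ℤ) : MeasurableSet (usable K L R c) :=
  (measurableSet_touched K L R c).compl.inter (measurableSet_jumpBridged K L R c).compl

/-! ### Two elementary estimates -/

/-- `∑_{d = K+1}^{CK} 1/d ≤ 1 + log C` (harmonic numbers: `H_{CK} - H_K ≤ 1 + log (CK) -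
log (K+1)`). [folklore] -/
theorem sum_Ioc_inv_le_one_add_log {k C : ℕ} (hk : 1 ≤ k) (hC : 1 ≤ C) :
    ∑ d ∈ Finset.Ioc k (C * k), (d : ℝ)⁻¹ ≤ 1 + Real.log C := by
  have hH : ∀ n : ℕ, ((harmonic n : ℚ) : ℝ) = ∑ i ∈ Finset.Ioc 0 n, (i : ℝ)⁻¹ := by
    intro n
    have hI : Finset.Icc 1 n = Finset.Ioc 0 n := by
      ext i; simp only [Finset.mem_Icc, Finset.mem_Ioc]; omega
    rw [harmonic_eq_sum_Icc, hI]; push_cast; rfl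
  have hsplit := Finset.sum_Ioc_consecutive (fun i : ℕ => (i : ℝ)⁻¹) (Nat.zero_le k)
    (Nat.le_mul_of_pos_left k hC)
  have h1 := harmonic_le_one_add_log (C * k)
  have h2 := log_add_one_le_harmonic k
  rw [hH] at h1 h2
  have hk0 : (0 : ℝ) < k := by exact_mod_cast hk
  have hC0 : (0 : ℝ) < C := by exact_mod_cast hC
  have hlog : Real.log ((C * k : ℕ) : ℝ) = Real.log C + Real.log k := by
    push_cast; exact Real.log_mul hC0.ne' hk0.ne'
  have hlogk : Real.log k ≤ Real.log ((k + 1 : ℕ) : ℝ) :=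
    Real.log_le_log hk0 (by push_cast; linarith)
  linarith

/-- `exp (-(1+δ) u) ≤ 1 - u` for `0 ≤ u ≤ δ/(1+δ)` (`log (1 - u) ≥ -u/(1-u)`, Mathlib's
`Real.one_sub_inv_le_log_of_pos`). [folklore] -/
theorem exp_neg_mul_le_one_sub {δ u : ℝ} (hδ : 0 < δ) (hu0 : 0 ≤ u) (hu : u ≤ δ / (1 + δ)) :
    Real.exp (-((1 + δ) * u)) ≤ 1 - u := by
  have hu1 : u < 1 := lt_of_le_of_lt hu (by rw [div_lt_one (by linarith)]; linarith)
  have hpos : 0 < 1 - u := by linarith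
  rw [← Real.log_le_log_iff (Real.exp_pos _) hpos, Real.log_exp]
  refine le_trans ?_ (Real.one_sub_inv_le_log_of_pos hpos)
  -- `-(1+δ) u ≤ 1 - (1-u)⁻¹ = -u/(1-u)` iff `(1+δ)(1-u) ≥ 1` iff `u (1+δ) ≤ δ`
  rw [show (1 : ℝ) - (1 - u)⁻¹ = -(u / (1 - u)) by field_simp; ring, neg_le_neg_iff,
    div_le_iff₀ hpos]
  have : u * (1 + δ) ≤ δ := by rwa [le_div_iff₀ (by linarith)] at hu
  nlinarith

/-! ### Usable windows are not too rare: `P(U) ≥ c(β') C^{-s}` with `s < 1` -/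

/-- The renormalised bridge density `θ₂² = θ₁² + (2R+1)² β'/K²` of `real_isLongBridge_le`.
[cite: DuminilcopinGarbanTassion2024, §2.4 (proof of Lemma 3)] -/
def bridgeTheta (β' θ₁ : ℝ) (k R : ℕ) : ℝ :=
  θ₁ ^ 2 + ((2 * R + 1) * (2 * R + 1) : ℕ) * (β' / (k : ℝ) ^ 2)

/-- `0 ≤ θ₂²`. [folklore] -/
theorem bridgeTheta_nonneg {β' : ℝ} (hβ : 0 ≤ β') (θ₁ : ℝ) (k R : ℕ) :
    0 ≤ bridgeTheta β' θ₁ k R := by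
  unfold bridgeTheta; positivity

/-- **Usable windows have probability at least `e^{-152β'} e^{-s} C^{-s}`**, where
`s = (1+δ) β' θ₂²` (DGT20, proof of Lemma 3: "`P[B^i_K unbridged] ≥ ∏ P[{x,y} not a bridge] ≥
½ C^{-βθ²}`, where the first inequality is due to the FKG inequality, and the second to a
sum-integral comparison"). Here: Harris' inequality for the decreasing events `touchedᶜ` and
`(bridge_{xy})ᶜ`, the bridge bound, `1 - u ≥ e^{-(1+δ)u}`, at most `d` jump pairs of length
`d`, `d K_d ≤ β'/d` and `∑_{K < d ≤ CK} 1/d ≤ 1 + log C`.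
[cite: DuminilcopinGarbanTassion2024, §2.4 (proof of Lemma 3)] -/
theorem exp_le_real_usable {K : ℕ → unitInterval} {β' θ₁ δ : ℝ} (hβ : 0 < β') (hδ : 0 < δ)
    {k C R : ℕ} (hk : 1 ≤ k) (hC : 2 ≤ C) (hR : R ≤ k)
    (hdecay : ∀ n : ℕ, k < n → (K n : ℝ) ≤ β' / (n : ℝ) ^ 2) (hk2 : 2 * β' ≤ ((k : ℝ) + 1) ^ 2)
    (hθ : (lrMeasure K).real {ω | exits R ω 0} ≤ θ₁)
    (hsmall : bridgeTheta β' θ₁ k R * (β' / (k : ℝ) ^ 2) ≤ δ / (1 + δ)) (c : ℤ) :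
    Real.exp (-(152 * β')) * (Real.exp (-((1 + δ) * (β' * bridgeTheta β' θ₁ k R))) *
      Real.exp (-((1 + δ) * (β' * bridgeTheta β' θ₁ k R) * Real.log C))) ≤
      (lrMeasure K).real (usable k (C * k) R c) := by
  have hC1 : 1 ≤ C := le_trans (by norm_num) hC
  set L := C * k with hL
  set θ₂ := bridgeTheta β' θ₁ k R with hθ₂
  set μ := lrMeasure K with hμ
  set B : (Σ _ : ℕ, ℤ) → Set (BondConfig ℤ) := fun p => {ω | IsLongBridge L R ω (p.2 - p.1) p.2}
    with hB
  have hθ₂0 : 0 ≤ θ₂ := bridgeTheta_nonneg hβ.le θ₁ k R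
  have hkL2 : 2 * k ≤ L := by rw [hL]; exact Nat.mul_le_mul_right k hC
  have h2R : 2 * R ≤ L := by omega
  -- Step 1: Harris
  have hsub : (touched k L R c)ᶜ ∩ ⋂ p ∈ jumpIdx k L R c, (B p)ᶜ ⊆ usable k L R c := by
    rintro ω ⟨h1, h2⟩
    refine ⟨h1, ?_⟩
    rw [Set.mem_compl_iff, jumpBridged_eq_biUnion]
    simp only [Set.mem_iUnion, not_exists, exists_prop, not_and]
    exact fun p hp => Set.mem_iInter₂.1 h2 p hp
  have hBm : ∀ p, MeasurableSet (B p) := fun p => measurableSet_isLongBridge L R _ _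
  have hBl : ∀ p, IsLowerSet (B p)ᶜ := fun p => (isUpperSet_isLongBridge L R _ _).compl
  have hharris : μ.real (touched k L R c)ᶜ * ∏ p ∈ jumpIdx k L R c, μ.real (B p)ᶜ ≤
      μ.real (usable k L R c) := by
    refine le_trans ?_ (measureReal_mono hsub)
    refine le_trans (mul_le_mul_of_nonneg_left
      (prodBernoulli_prod_le_real_iInter_of_isLowerSet _ (jumpIdx k L R c) (fun p _ => hBl p)
        fun p _ => (hBm p).compl) measureReal_nonneg) ?_
    exact prodBernoulli_harris_lower _ (isUpperSet_touched k L R c).compl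
      (isLowerSet_iInter₂ fun p _ => hBl p) (measurableSet_touched k L R c).compl
      (Finset.measurableSet_biInter _ fun p _ => (hBm p).compl)
  refine le_trans ?_ hharris
  refine mul_le_mul (exp_le_real_compl_touched hβ hdecay hk2 (by omega) c) ?_ (by positivity)
    measureReal_nonneg
  -- Step 2: each factor `P((B p)ᶜ) = 1 - P(B p) ≥ 1 - K_d θ₂ ≥ exp (-(1+δ) K_d θ₂)`
  have hKd : ∀ d : ℕ, k < d → (K d : ℝ) * θ₂ ≤ δ / (1 + δ) := by
    intro d hd
    refine le_trans ?_ hsmall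
    rw [mul_comm]
    refine mul_le_mul_of_nonneg_left (le_trans (hdecay d hd) ?_) hθ₂0
    refine div_le_div_of_nonneg_left hβ.le (by positivity) ?_
    have : (k : ℝ) ≤ d := by exact_mod_cast hd.le
    nlinarith
  have hfac : ∀ p ∈ jumpIdx k L R c,
      Real.exp (-((1 + δ) * ((K p.1 : ℝ) * θ₂))) ≤ μ.real (B p)ᶜ := by
    intro p hp
    simp only [jumpIdx, Finset.mem_sigma, Finset.mem_Ioc] at hp
    have hd : k < p.1 := by omega
    rw [probReal_compl_eq_one_sub (hBm p)]
    refine le_trans (exp_neg_mul_le_one_sub hδ (mul_nonneg (K p.1).2.1 hθ₂0) (hKd p.1 hd)) ?_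
    have hb := real_isLongBridge_le (K := K) hβ.le hdecay hθ h2R hk (x := p.2 - p.1) (y := p.2)
      (by omega)
    have hp1 : (edgeProb K s(p.2 - ↑p.1, p.2) : ℝ) = K p.1 := by
      simp
    rw [hp1] at hb
    have hb' : μ.real (B p) ≤ (K p.1 : ℝ) * θ₂ := hb
    linarith
  refine le_trans ?_ (Finset.prod_le_prod (fun p _ => (Real.exp_pos _).le) hfac)
  -- Step 3: the product of exponentials
  rw [← Real.exp_sum, ← Real.exp_add, Real.exp_le_exp]
  have hsum : ∑ p ∈ jumpIdx k L R c, -((1 + δ) * ((K p.1 : ℝ) * θ₂)) =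
      -((1 + δ) * θ₂ * ∑ d ∈ Finset.Ioc (8 * k + 2 * R) L,
        ((Finset.Ioc (c + (4 * k + R)) (c - (4 * k + R) + d - 1)).card : ℝ) * (K d : ℝ)) := by
    rw [jumpIdx, Finset.sum_sigma, Finset.mul_sum, ← Finset.sum_neg_distrib]
    refine Finset.sum_congr rfl fun d _ => ?_
    simp only [Finset.sum_const, nsmul_eq_mul]
    ring
  rw [hsum]
  -- goal: `-(a log C) ≤ -(b Σ) + a`, i.e. `b Σ ≤ a + a log C`
  -- with `a = (1+δ) β' θ₂`, `b = (1+δ) θ₂`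
  suffices key : (1 + δ) * θ₂ * ∑ d ∈ Finset.Ioc (8 * k + 2 * R) L,
      ((Finset.Ioc (c + (4 * k + R)) (c - (4 * k + R) + d - 1)).card : ℝ) * (K d : ℝ) ≤
      (1 + δ) * (β' * θ₂) + (1 + δ) * (β' * θ₂) * Real.log C by linarith
  have hcnt : ∀ d ∈ Finset.Ioc (8 * k + 2 * R) L,
      ((Finset.Ioc (c + (4 * k + R)) (c - (4 * k + R) + d - 1)).card : ℝ) * (K d : ℝ) ≤
        β' * (d : ℝ)⁻¹ := by
    intro d hd
    rw [Finset.mem_Ioc] at hd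
    have hcard : ((Finset.Ioc (c + (4 * k + R)) (c - (4 * k + R) + d - 1)).card : ℝ) ≤ d := by
      rw [Int.card_Ioc]
      have : ((c - (4 * k + R) + d - 1 - (c + (4 * k + R))).toNat : ℤ) ≤ d := by omega
      exact_mod_cast this
    have hd0 : (0 : ℝ) < d := by exact_mod_cast (show 0 < d by omega)
    calc ((Finset.Ioc (c + (4 * k + R)) (c - (4 * k + R) + d - 1)).card : ℝ) * (K d : ℝ)
        ≤ (d : ℝ) * (β' / (d : ℝ) ^ 2) :=
          mul_le_mul hcard (hdecay d (by omega)) (K d).2.1 hd0.le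
      _ = β' * (d : ℝ)⁻¹ := by field_simp
  have hS : ∑ d ∈ Finset.Ioc (8 * k + 2 * R) L,
      ((Finset.Ioc (c + (4 * k + R)) (c - (4 * k + R) + d - 1)).card : ℝ) * (K d : ℝ) ≤
        β' * (1 + Real.log C) := by
    refine le_trans (Finset.sum_le_sum hcnt) ?_
    rw [← Finset.mul_sum]
    refine mul_le_mul_of_nonneg_left ?_ hβ.le
    refine le_trans (Finset.sum_le_sum_of_subset_of_nonneg (fun d hd => ?_)
      fun d _ _ => inv_nonneg.2 (Nat.cast_nonneg d)) (sum_Ioc_inv_le_one_add_log hk hC1)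
    rw [Finset.mem_Ioc] at hd ⊢; omega
  have h1δ : 0 ≤ (1 + δ) * θ₂ := by positivity
  calc (1 + δ) * θ₂ * ∑ d ∈ Finset.Ioc (8 * k + 2 * R) L,
        ((Finset.Ioc (c + (4 * k + R)) (c - (4 * k + R) + d - 1)).card : ℝ) * (K d : ℝ)
      ≤ (1 + δ) * θ₂ * (β' * (1 + Real.log C)) := mul_le_mul_of_nonneg_left hS h1δ
    _ = (1 + δ) * (β' * θ₂) + (1 + δ) * (β' * θ₂) * Real.log C := by ring

end Literature.Probability.Percolation
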